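import Summits.BirchSwinnertonDyer.Rank1Residual.Additive.X3BranchKummerLayerTwoUnitsSum
import Summits.BirchSwinnertonDyer.Rank1Residual.Additive.X3BranchLayerTwoCubicResidues
import Summits.BirchSwinnertonDyer.Rank1Residual.Additive.X3BranchResidualQuotSelmerLayerLowerBound
import HarnessLib

/-!
# X3, the DEGENERATE rows OFF the sub-locus, LAYER TWO: the U-side LOWER BOUND `3^{#ι} ≤ #U(W[3]/Φ₀)`
# from Kummer classes of `Σ₀`-units of the SECOND LAYER `ℚ_2 = ℚ(ζ₂₇)⁺`, independence by CUBIC RESIDUES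
# in `ℤ[θ₂]` (cell `bsd-eis`, seat `bsd-eis-x3` gen 8; the layer-`2` analogue of gen 7's
# `X3BranchResidualQuotSelmerLayerLowerBound.lean`, built on the conjugate-free
# `LayerTwoField.kummerSumClass_mem_unramifiedSelmer_layerTwo` and
# `LayerTwoField.eq_zero_of_cube_eq_prod_layerTwo`; x3-MEMO-10 §5 (U4); route K1 `AdditiveBranchIMC`,
# crux `GordTwoRankZeroOffCaseOne` — supports only)

HONEST FRAMING (`run/shared/lean/pub/bsd-eis/README.md` §4): THEOREMS ONLY (no `def`, no named fact,
no `sorry`); nothing is booked; no label, tier or count of record moves.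

* `X3Branch.pow_card_le_natCard_residualQuotSelmer_of_trivialLine_layerTwo` — for the cyclotomic `κ`,
  a rational line `Φ₀` fixed pointwise, `θ₂ = ζ + ζ²⁶` (`ζ` of order `27`) with its multiplication table
  `μ`; `ι` units `a_i = Σ_k P_{ik} θ₂^k` with cofactors `b_i` (`a_i b_i = n_i ≠ 0`, primes of `n_i` in `Σ₀`),
  ONE cube certificate each (`a_i D_i³ = 1 + 9T_i`), and the cubic-residue certificate at primes
  `q ≡ 1 (mod 3)` where `f₉` has nine roots (`9×9` Vandermonde inverse, `ω`, exponents `e`, left inverse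
  `L`): `3^{#ι} ≤ #U` (`residualQuotSelmer`, assumed finite).
References: [GreenbergVatsal2000] §2 pp. 28–30; [SerreLocalFields1979] Ch. X §3; [Washington1997] §13.1.
-/

set_option autoImplicit false

noncomputable section

open scoped Classical AddSubgroup NumberField

namespace Summit.BirchSwinnertonDyer.Rank1Residual.Additive

open NumberField IsDedekindDomain Field WeierstrassCurve Polynomial
  Literature.NumberTheory.GaloisRepresentations
  Literature.NumberTheory.EllipticCurves
  Literature.NumberTheory.EllipticCurves.GreenbergSelmer
  Literature.NumberTheory.EllipticCurves.GreenbergVatsal2000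
  Literature.NumberTheory.EllipticCurves.Rank1Residual
  Literature.NumberTheory.NumberFields
  Summit.BirchSwinnertonDyer.Rank1Residual.X2.ResidualDevissageModules
  Summit.BirchSwinnertonDyer.Rank1Residual.X2.ResidualDevissageLine
  KummerLineClasses KummerLayerClasses LayerTwoField

section Main

variable {W : WeierstrassCurve ℚ} [W.IsElliptic]

/-- **LOWER BOUND for GV's `U(W[3]/Φ₀)` from Kummer classes of `Σ₀`-units of the second layer `ℚ_2`.**
See the module docstring. [cite: GreenbergVatsal2000, §2 pp. 28–30] [cite: SerreLocalFields1979, Ch. X §3]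
[cite: Washington1997, §13.1] -/
theorem _root_.Summit.BirchSwinnertonDyer.Rank1Residual.Additive.X3Branch.pow_card_le_natCard_residualQuotSelmer_of_trivialLine_layerTwo
    [hp : Fact (Nat.Prime 3)] (κ : ZpExtension ℚ 3) (hκ : κ.IsCyclotomic)
    (S₀ : Finset (HeightOneSpectrum (𝓞 ℚ)))
    {Φ₀ : AddSubgroup (W.geomTorsion ((3 : ℕ) : ℤ))} (hΦ : IsRationalLine W 3 Φ₀)
    (htriv : ∀ (σ : absoluteGaloisGroup ℚ) (Pt : geomTorsion W ((3 : ℕ) : ℤ)), Pt ∈ Φ₀ → σ • Pt = Pt)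
    {ζ : AlgebraicClosure ℚ} (hζ : IsPrimitiveRoot ζ 27)
    (μ : Fin 9 → Fin 9 → Fin 9 → ℤ)
    (hθtab : ∀ i j : Fin 9, (ζ + ζ ^ 26) ^ (i : ℕ) * (ζ + ζ ^ 26) ^ (j : ℕ) =
      ∑ k : Fin 9, (μ k i j : AlgebraicClosure ℚ) * (ζ + ζ ^ 26) ^ (k : ℕ))
    {ι : Type} [Fintype ι] [DecidableEq ι]
    (P B D T : ι → Fin 9 → ℤ) (n : ι → ℕ) (hn0 : ∀ i, n i ≠ 0)
    (hab : ∀ i, (∑ k : Fin 9, (P i k : AlgebraicClosure ℚ) * (ζ + ζ ^ 26) ^ (k : ℕ)) *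
      (∑ k : Fin 9, (B i k : AlgebraicClosure ℚ) * (ζ + ζ ^ 26) ^ (k : ℕ)) = (n i : AlgebraicClosure ℚ))
    (hnS : ∀ i (v : HeightOneSpectrum (𝓞 ℚ)), ((n i : ℕ) : 𝓞 ℚ) ∈ v.asIdeal → v ∈ S₀)
    (hcube : ∀ i, (∑ k : Fin 9, (P i k : AlgebraicClosure ℚ) * (ζ + ζ ^ 26) ^ (k : ℕ)) *
      (∑ k : Fin 9, (D i k : AlgebraicClosure ℚ) * (ζ + ζ ^ 26) ^ (k : ℕ)) ^ 3 =
      1 + 9 * ∑ k : Fin 9, (T i k : AlgebraicClosure ℚ) * (ζ + ζ ^ 26) ^ (k : ℕ))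
    {R : ℕ} (q : Fin R → ℕ) (hq : ∀ ρ, (q ρ).Prime) (hq1 : ∀ ρ, 3 ∣ q ρ - 1)
    (r : (ρ : Fin R) → Fin 9 → ZMod (q ρ))
    (hr : ∀ ρ kk, r ρ kk ^ 9 - 9 * r ρ kk ^ 7 + 27 * r ρ kk ^ 5 - 30 * r ρ kk ^ 3 + 9 * r ρ kk + 1 = 0)
    (w : (ρ : Fin R) → Fin 9 → Fin 9 → ZMod (q ρ))
    (hw : ∀ ρ (a a' : Fin 9), ∑ kk, w ρ a kk * r ρ kk ^ a'.val = if a = a' then 1 else 0)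
    (ω : (ρ : Fin R) → ZMod (q ρ)) (hω : ∀ ρ, ω ρ ^ 3 = 1 ∧ ω ρ ≠ 1)
    (e : Fin R → ι → ℕ)
    (he : ∀ ρ i, (∑ k : Fin 9, (P i k : ZMod (q ρ)) * r ρ 0 ^ (k : ℕ)) ^ ((q ρ - 1) / 3) = ω ρ ^ e ρ i)
    (hnz : ∀ ρ i, (∑ k : Fin 9, (P i k : ZMod (q ρ)) * r ρ 0 ^ (k : ℕ)) ≠ 0)
    (L : ι → Fin R → ℤ)
    (hL : ∀ i i', (∑ ρ, (L i ρ : ZMod 3) * (e ρ i' : ZMod 3)) = if i = i' then 1 else 0)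
    [Finite (residualQuotSelmer W 3 κ S₀ Φ₀ hΦ)] :
    3 ^ Fintype.card ι ≤ Nat.card (residualQuotSelmer W 3 κ S₀ Φ₀ hΦ) := by
  haveI : NeZero ((3 : ℕ) : ℚ) := ⟨by norm_num⟩
  haveI : ∀ ρ, Fact (q ρ).Prime := fun ρ ↦ ⟨hq ρ⟩
  set θ : AlgebraicClosure ℚ := ζ + ζ ^ 26 with hθdef
  have hζ₃ : IsPrimitiveRoot (ζ ^ 9) 3 := hζ.pow (by norm_num) (by norm_num)
  -- the `ω`-line `Ψ = W[3]/Φ₀` with a generator `y₀`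
  have hΨ := quot_smul_eq_cyclotomic_of_trivialLine (p := 3) hΦ htriv
  obtain ⟨y₀, hy₀, hgen⟩ := exists_generator_quot (p := 3) hΦ
  have hy₀3 : 3 • y₀ = 0 := by
    have h := addOrderOf_nsmul_eq_zero y₀
    rwa [hy₀] at h
  -- `θ₂` is fixed by `κ⁻¹(9ℤ₃) ⊇ ker κ`
  have hG2θ : ∀ σ ∈ κ.layerSubgroup 2, σ • θ = θ := by
    intro σ hσ
    have hmem := zeta_add_pow_mem_layer_two hκ ζ hζ.pow_eq_one
    rw [ZpExtension.layer, IntermediateField.mem_fixedField_iff] at hmem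
    exact hmem _ (Subgroup.mem_map.mpr ⟨σ, hσ, rfl⟩)
  have hkerθ : ∀ σ ∈ κ.kerSubgroup, σ • θ = θ := fun σ hσ ↦
    hG2θ σ (κ.kerSubgroup_le_layerSubgroup 2 hσ)
  -- the units
  set a : ι → AlgebraicClosure ℚ := fun i ↦ ∑ kk : Fin 9, (P i kk : AlgebraicClosure ℚ) * θ ^ (kk : ℕ)
    with hadef
  have ha0 : ∀ i, a i ≠ 0 := fun i h0 ↦ hn0 i (by
    have := hab i
    rw [show (∑ kk : Fin 9, (P i kk : AlgebraicClosure ℚ) * (ζ + ζ ^ 26) ^ (kk : ℕ)) = a i from rfl,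
      h0, zero_mul] at this
    exact_mod_cast this.symm)
  have hG2a : ∀ i, ∀ σ ∈ κ.layerSubgroup 2, σ • a i = a i := fun i σ hσ ↦ by
    change σ • (∑ kk : Fin 9, (P i kk : AlgebraicClosure ℚ) * θ ^ (kk : ℕ)) = _
    rw [smul_sum9, hG2θ σ hσ]
  have hkera : ∀ i, ∀ σ ∈ κ.kerSubgroup, σ • a i = a i := fun i σ hσ ↦
    hG2a i σ (κ.kerSubgroup_le_layerSubgroup 2 hσ)
  -- good cube roots (for `τ = 1`) and Kummer cocycles on `ker κ`
  have hroots : ∀ i, ∃ βi : AlgebraicClosure ℚ, βi ^ 3 = a i := fun i ↦ by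
    obtain ⟨βi, hβi, -⟩ := exists_goodRoot_layerTwo hκ hζ μ hθtab (P i) (D i) (T i) (hcube i) 1
    exact ⟨βi, by rw [hβi, one_smul]⟩
  choose β hβ' using hroots
  have hβ0 : ∀ i, β i ≠ 0 := fun i h0 ↦ by
    have := hβ' i; rw [h0, zero_pow three_ne_zero] at this; exact ha0 i this.symm
  choose f hfc hfcoc hfrel using fun i ↦
    exists_kummerCocycle (p := 3) κ.kerSubgroup hΨ y₀ hy₀3 hζ₃ (ha0 i) (hkera i) (hβ' i)
  -- `3`-torsion bookkeeping in `Ψ`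
  have h3Ψ : ∀ y : (lineSub Φ₀ hΦ).Quot, 3 • y = 0 := fun y ↦ by
    obtain ⟨t, rfl⟩ := hgen y
    rw [← mul_nsmul, mul_comm, mul_nsmul, hy₀3, nsmul_zero]
  have hmodΨ : ∀ (y : (lineSub Φ₀ hΦ).Quot) (u v : ℕ), (u : ZMod 3) = v → u • y = v • y :=
    fun y u v h ↦ by
      rw [nsmul_eq_mod_nsmul u (h3Ψ y), nsmul_eq_mod_nsmul v (h3Ψ y),
        (ZMod.natCast_eq_natCast_iff' u v 3).mp h]
  have hsubΨ : ∀ (y : (lineSub Φ₀ hΦ).Quot) (k k' : ZMod 3),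
      k.val • y - k'.val • y = (k - k').val • y := fun y k k' ↦ by
    rw [sub_eq_iff_eq_add, ← add_nsmul]
    apply hmodΨ
    push_cast
    simp only [ZMod.natCast_val, ZMod.cast_id', id_eq, sub_add_cancel]
  -- the combinations `F k = Σ k_i f_i`
  set F : (ι → ZMod 3) → absoluteGaloisGroup ℚ → (lineSub Φ₀ hΦ).Quot :=
    fun k σ ↦ ∑ i, (k i).val • f i σ with hFdef
  haveI : ContinuousAdd (lineSub Φ₀ hΦ).Quot := ⟨continuous_of_discreteTopology⟩
  have hFc : ∀ k, Continuous (F k) := fun k ↦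
    continuous_finsetSum _ fun i _ ↦ (continuous_nsmul (k i).val).comp (hfc i)
  have hFcoc : ∀ k, ∀ σ ∈ κ.kerSubgroup, ∀ τ ∈ κ.kerSubgroup, F k (σ * τ) = F k σ + σ • F k τ :=
    fun k σ hσ τ hτ ↦ by
      simp only [hFdef, hfcoc _ σ hσ τ hτ, nsmul_add, Finset.sum_add_distrib, Finset.smul_sum, smul_comm σ]
  have hFrel : ∀ k, ∀ σ ∈ κ.kerSubgroup, ∃ m : ℕ,
      σ • (∏ i, β i ^ (k i).val) = (ζ ^ 9) ^ m * ∏ i, β i ^ (k i).val ∧ F k σ = m • y₀ :=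
    fun k σ hσ ↦ rel_sum_at Finset.univ y₀ β f σ (fun i _ ↦ hfrel i σ hσ) (fun i ↦ (k i).val)
  have hFsub : ∀ k k' σ, F k σ - F k' σ = F (k - k') σ := fun k k' σ ↦ by
    simp only [hFdef, ← Finset.sum_sub_distrib, hsubΨ, Pi.sub_apply]
  -- the classes `c k = [F k|_{G_{ℚ_∞}}]`
  choose Fc cls hFc1 hcls using fun k ↦
    exists_class_of_cocycle κ.kerSubgroup le_rfl (F k) (hFc k) (hFcoc k)
  -- MEMBERSHIP in `U` (`X3BranchKummerLayerTwoUnitsSum.lean`)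
  have hmem : ∀ k, cls k ∈ unramifiedSelmer κ.kerSubgroup (lineSub Φ₀ hΦ).Quot 3
      (↑S₀ : Set (HeightOneSpectrum (𝓞 ℚ))) := fun k ↦ by
    rw [hcls k]
    exact kummerSumClass_mem_unramifiedSelmer_layerTwo κ hκ S₀ hΨ hy₀3 hζ μ hθtab P B D T n hn0 hab hnS
      hcube β hβ' (fun i ↦ (k i).val) (Fc k)
      (fun h ↦ by
        obtain ⟨m, hm, hFm⟩ := hFrel k h h.2
        exact ⟨m, hm, by rw [hFc1]; exact hFm⟩)
  -- INJECTIVITY: a vanishing class forces `d = 0`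
  have hzero : ∀ d : ι → ZMod 3, cls d = 0 → d = 0 := by
    intro d hd
    rw [hcls d, oneCocycleClass_eq_zero_iff] at hd
    obtain ⟨y, hy⟩ := hd
    have hcob : ∀ h ∈ κ.kerSubgroup, F d h = h • y - y := fun h hh ↦ by
      have := hy ⟨h, hh⟩
      rw [hFc1 d ⟨h, hh⟩] at this
      exact this
    set A : AlgebraicClosure ℚ := ∏ i, a i ^ (d i).val with hA
    have hA0 : A ≠ 0 := Finset.prod_ne_zero_iff.mpr fun i _ ↦ pow_ne_zero _ (ha0 i)
    have hBA : (∏ i, β i ^ (d i).val) ^ 3 = A := by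
      rw [← Finset.prod_pow, hA]
      exact Finset.prod_congr rfl fun i _ ↦ by rw [← pow_mul, mul_comm, pow_mul, hβ' i]
    obtain ⟨γ, hγ, hγfix⟩ := KummerLayerClasses.exists_fixed_root_of_coboundary (p := 3) hΨ hy₀ hgen hζ₃
      hBA (hFrel d) κ.kerSubgroup le_rfl hcob
    -- `γ` is fixed by `κ⁻¹(9ℤ₃)`
    have hAG : ∀ σ ∈ κ.layerSubgroup 2, σ • A = A := fun σ hσ ↦ by
      rw [hA, Finset.smul_prod']
      exact Finset.prod_congr rfl fun i _ ↦ by rw [smul_pow', hG2a i σ hσ]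
    have hγG : ∀ σ ∈ κ.layerSubgroup 2, σ • γ = γ := fun σ hσ ↦
      smul_eq_self_of_fixed_kerSubgroup (p := 3) (by decide) κ hζ₃ hA0 hγ hAG hγfix hσ
    exact eq_zero_of_cube_eq_prod_layerTwo hκ hζ P (by rw [hγ, hA]) hγG q hq hq1 r hr w hw ω hω
      e he hnz L hL
  -- COUNTING
  haveI hfin : Finite (unramifiedSelmer κ.kerSubgroup (lineSub Φ₀ hΦ).Quot 3
      (↑S₀ : Set (HeightOneSpectrum (𝓞 ℚ)))) := ‹Finite (residualQuotSelmer W 3 κ S₀ Φ₀ hΦ)›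
  let Fmap : (ι → ZMod 3) → unramifiedSelmer κ.kerSubgroup (lineSub Φ₀ hΦ).Quot 3
      (↑S₀ : Set (HeightOneSpectrum (𝓞 ℚ))) := fun k ↦ ⟨cls k, hmem k⟩
  have hinj : Function.Injective Fmap := by
    intro k k' hkk'
    have h1 : cls k = cls k' := congrArg Subtype.val hkk'
    have h2 : cls (k - k') = 0 := by
      have e' : Fc k - Fc k' = Fc (k - k') := by
        apply Subtype.ext
        ext h
        change (Fc k).1 h - (Fc k').1 h = (Fc (k - k')).1 h
        rw [hFc1, hFc1, hFc1, hFsub]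
      rw [hcls, ← e', oneCocycleClass_sub, ← hcls, ← hcls, h1, sub_self]
    exact sub_eq_zero.mp (hzero _ h2)
  have hcard := Nat.card_le_card_of_injective Fmap hinj
  rw [Nat.card_fun, Nat.card_zmod, Nat.card_eq_fintype_card] at hcard
  exact hcard

end Main

end Summit.BirchSwinnertonDyer.Rank1Residual.Additive

end
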